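import Literature.Computability.Complexity.TotalSearchProblem
import HarnessLib

/-!
# Promise form versus printed form of a search problem: totalization

Companion of `TotalSearchProblem.lean`. The printed definitions of search problems and `TFNP`
(Megiddo–Papadimitriou 1991, p. 317; Papadimitriou 1994, §2; Fearnley–Goldberg–Hollender–Savani
2022, §3.1.1) have no promise, while the tree's `SearchProblem` carries a set `valid` of
instances and `FNP`/`TFNP` admit a `P`-decidable promise. This file records why that is
harmless: the **totalization** `R.totalize` ("every string is an instance; an invalid instance
has the default solution `[]`" — the usual reading of "the side condition can be enforced
syntactically, so this is indeed a TFNP problem and not a promise problem", FGHS 2022, §3.1.2)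
satisfies

* `isTotal_totalize_iff : R.totalize.IsTotal ↔ R.IsTotal`;
* `manyOneReducible_totalize : R ≤ₘ R.totalize` (always);
* `totalize_manyOneReducible : R.totalize ≤ₘ R` when `R.valid ∈ P` (and some valid instance
  exists) — by branching (`iteFn`, `BranchingFn.lean`) on the indicator of `valid`
  (`indicatorFn_mem_FP`).

So for a `P`-decidable promise the promise form and the printed form are many-one equivalent,
and present the same syntactic subclass (`TFNP.closureOf_mono`).

## References

* J. Fearnley, P. W. Goldberg, A. Hollender, R. Savani, *The complexity of gradient descent:
  CLS = PPAD ∩ PLS*, J. ACM 70 (2022); arXiv:2011.01929, §3.1.2 ("can be enforced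
  syntactically"), §3.1.3 (promise-preserving reductions).
* J. Fearnley, S. Gordon, R. Mehta, R. Savani, *Unique end of potential line*, J. Comput. System
  Sci. 114 (2020); arXiv:1811.03841, §2 (promise versions of total search problems).
-/

namespace Literature.Computability.Complexity

open _root_.Computability

namespace SearchProblem

variable (R : SearchProblem)

/-- **Totalization** of a promise problem: every string is an instance, and an invalid instance
has the default solution `[]` (besides whatever `rel` gives it) — the usual reading of "the side
condition can be enforced syntactically". [FGHS 2022, §3.1.2; FGMS 2020, §2]
[cite: FearnleyGoldbergHollenderSavani2022, §3.1.2] -/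
def totalize (R : SearchProblem) : SearchProblem where
  valid := Set.univ
  rel := {z | ∃ x y : List Bool, z = boolPair x y ∧ (x ∉ R.valid ∧ y = [] ∨ boolPair x y ∈ R.rel)}

/-- Solutions of the totalization. [folklore] -/
@[simp] theorem boolPair_mem_totalize_rel (x y : List Bool) :
    boolPair x y ∈ R.totalize.rel ↔ x ∉ R.valid ∧ y = [] ∨ boolPair x y ∈ R.rel := by
  constructor
  · rintro ⟨x', y', h, h'⟩
    obtain ⟨rfl, rfl⟩ := Prod.mk.inj (boolPair_injective (a₁ := (x, y)) (a₂ := (x', y')) h)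
    exact h'
  · exact fun h => ⟨x, y, rfl, h⟩

/-- The totalization is total iff the problem is total on its valid instances. [FGHS 2022,
§3.1.2] [cite: FearnleyGoldbergHollenderSavani2022, §3.1.2] -/
theorem isTotal_totalize_iff : R.totalize.IsTotal ↔ R.IsTotal := by
  constructor
  · intro h x hx
    obtain ⟨y, hy⟩ := h x (Set.mem_univ x)
    rcases (R.boolPair_mem_totalize_rel x y).1 hy with ⟨hx', -⟩ | h'
    · exact (hx' hx).elim
    · exact ⟨y, h'⟩
  · intro h x _
    by_cases hx : x ∈ R.valid
    · obtain ⟨y, hy⟩ := h x hx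
      exact ⟨y, (R.boolPair_mem_totalize_rel x y).2 (Or.inr hy)⟩
    · exact ⟨[], (R.boolPair_mem_totalize_rel x _).2 (Or.inl ⟨hx, rfl⟩)⟩

/-- **`R ≤ₘ R.totalize`** (identity on instances, second projection on solutions: a solution of a
VALID instance in the totalization is a solution). [FGHS 2022, §3.1.2]
[cite: FearnleyGoldbergHollenderSavani2022, §3.1.2] -/
theorem manyOneReducible_totalize : R.ManyOneReducible R.totalize :=
  ⟨id, PolyTimeComputable.id _, fun z => (boolUnpair z).2, boolUnpairSnd_mem_FP, fun x hx =>
    ⟨Set.mem_univ _, fun y hy => by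
      rcases (R.boolPair_mem_totalize_rel x y).1 hy with ⟨hx', -⟩ | h'
      · exact (hx' hx).elim
      · simpa only [boolUnpair_boolPair] using h'⟩⟩

/-- **`R.totalize ≤ₘ R` for a `P`-decidable promise** (and some valid instance `x₀`): send an
invalid instance to `x₀` and answer it by `[]`, using the indicator of `valid` (`∈ FP` since
`valid ∈ P`) and the branching combinator `iteFn`. Together with `manyOneReducible_totalize`:
promise form and printed form are many-one equivalent when the promise is in `P`.
[FGHS 2022, §3.1.2 ("can be enforced syntactically, so this is indeed a TFNP problem and not a
promise problem")] [cite: FearnleyGoldbergHollenderSavani2022, §3.1.2] -/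
theorem totalize_manyOneReducible (hv : R.valid ∈ Classes.P) {x₀ : List Bool} (hx₀ : x₀ ∈ R.valid) :
    R.totalize.ManyOneReducible R := by
  classical
  set c : List Bool → List Bool := fun x => encodeBool (R.valid.boolIndicator x) with hc
  have hcFP : c ∈ FP := indicatorFn_mem_FP hv
  have hc_of_mem : ∀ {x}, x ∈ R.valid → c x = [true] := fun hx => by
    simp only [hc, (Set.mem_iff_boolIndicator _ _).1 hx]; rfl
  have hc_of_not_mem : ∀ {x}, x ∉ R.valid → c x = [false] := fun hx => by
    simp only [hc, (Set.notMem_iff_boolIndicator _ _).1 hx]; rfl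
  refine ⟨iteFn c id (fun _ => x₀), iteFn_mem_FP hcFP (PolyTimeComputable.id _) (const_mem_FP x₀),
    iteFn (c ∘ fun z => (boolUnpair z).1) (fun z => (boolUnpair z).2) (fun _ => []),
    iteFn_mem_FP (comp_mem_FP hcFP boolUnpairFst_mem_FP) boolUnpairSnd_mem_FP (const_mem_FP []),
    fun x _ => ?_⟩
  by_cases hx : x ∈ R.valid
  · have h1 : iteFn c id (fun _ => x₀) x = x := iteFn_apply_true (hc_of_mem hx)
    refine ⟨by rw [h1]; exact hx, fun y hy => ?_⟩
    have h2 : iteFn (c ∘ fun z => (boolUnpair z).1) (fun z => (boolUnpair z).2) (fun _ => []) (boolPair x y) = y := by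
      rw [iteFn_apply_true (by simp only [Function.comp_apply, boolUnpair_boolPair, hc_of_mem hx])]
      simp only [boolUnpair_boolPair]
    rw [h2]
    rw [h1] at hy
    exact (R.boolPair_mem_totalize_rel x y).2 (Or.inr hy)
  · have h1 : iteFn c id (fun _ => x₀) x = x₀ := iteFn_apply_false (hc_of_not_mem hx)
    refine ⟨by rw [h1]; exact hx₀, fun y _ => ?_⟩
    have h2 : iteFn (c ∘ fun z => (boolUnpair z).1) (fun z => (boolUnpair z).2) (fun _ => []) (boolPair x y) = [] :=
      iteFn_apply_false (by simp only [Function.comp_apply, boolUnpair_boolPair, hc_of_not_mem hx])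
    rw [h2]
    exact (R.boolPair_mem_totalize_rel x _).2 (Or.inl ⟨hx, rfl⟩)

end SearchProblem

end Literature.Computability.Complexity
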